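import Summits.CriticalPhenomena.SAWScalingLimit.Theorems.LeftRightFKG.Negative.PAKitDefs
import Summits.CriticalPhenomena.SAWScalingLimit.Theorems.LeftRightFKG.Negative.OrderCharacterisation
import Summits.CriticalPhenomena.SAWScalingLimit.Theorems.SAWLeftRightFKGLeftRightFKGStubEndpointMonotone
import HarnessLib

/-!
# Negative knowledge on crux `LeftRightFKG`, part 16: `PAKit` soundness II — the dictionary codes ↔ chords

Crux `stmt-CriticalPhenomena-11232`.  §7 of the kit: on a box instance (`hB`: adjacency of `Ω_1` is lattice
adjacency inside the indicator `inV`), the code `γ.walk.support.map toZ2` of a chord determines everything the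
checker reads: `getV_code` / `getVR_code` (vertices from the front / back), `wcZ_code` (face crossing counts =
`wcross`), `lr_of_lrCode` (the decidable test implies the crux order `≼`, via part 6), and `sum_filter_eq_listSum`
(a fugacity sum over a decidable-on-codes set of chords is the corresponding sum over the filtered certified
enumeration, via the bijection of `BoxCensus`); §7b: the certified enumeration has no duplicates (`codes_nodup`,
from `pathsFrom_nodup` — so instances need no per-box `decide`).  Elementary ("folklore").
-/

namespace Summit.CriticalPhenomena.SAWScalingLimit.Theorems.LeftRightFKG.Negative.PAKit

open Literature.Analysis.ValidatedNumerics
open PolyMP (evalR addR mulR smulR posOn)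
open PolyCert (realOf minorI)
open Census (censusList census)

/-! ## §7 The dictionary codes ↔ chords -/

section Dictionary

open Literature.Probability.LatticeModels Literature.Probability.RandomPlanarGeometry
open Summit.CriticalPhenomena.SAWScalingLimit.Theorems.BoundaryTP2.Negative (pathsFrom endsAt)
open Census (eqZ2 nbV)

variable {Ω : Set ℂ} {a b : Site 2}

/-- `getV` on the code reads the chord's vertices (`Walk.getVert`, saturating at `b`). [folklore] -/
theorem getV_code (γ : SAW.DomainSAW Ω 1 a b) (i : ℕ) :
    getV (toZ2 b) (γ.walk.support.map toZ2) i = toZ2 (γ.walk.getVert i) := by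
  rw [getV, List.getD_map, SimpleGraph.Walk.getVert_eq_getD_support]

/-- `getVR` on the code reads the reversed chord's vertices. [folklore] -/
theorem getVR_code (γ : SAW.DomainSAW Ω 1 a b) (j : ℕ) :
    getVR (toZ2 b) (γ.walk.support.map toZ2) j = toZ2 (γ.walk.reverse.getVert j) := by
  have hl : (γ.walk.support.map toZ2).length - 1 - j = γ.walk.length - j := by
    rw [List.length_map, SimpleGraph.Walk.length_support]; omega
  rw [getVR, hl, List.getD_map, SimpleGraph.Walk.getVert_reverse, SimpleGraph.Walk.getVert_eq_getD_support]

/-- `ecZ` mirrors `edgeCross`. [folklore] -/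
theorem ecZ_toZ2 (m k : ℤ) (p q : Site 2) : ecZ m k (toZ2 p) (toZ2 q) = edgeCross m k p q := by
  simp only [ecZ, edgeCross, toZ2_mk]
  split_ifs <;> rfl

/-- `pcZ` mirrors `pathCross`. [folklore] -/
theorem pcZ_map (m k : ℤ) : ∀ (p : Site 2) (l : List (Site 2)), pcZ m k (toZ2 p) (l.map toZ2) = pathCross m k p l
  | p, [] => rfl
  | p, q :: l => by rw [List.map_cons, pcZ, pathCross_cons, ecZ_toZ2, pcZ_map m k q l]

/-- `wcZ` on the code is the walk's crossing count `wcross`. [folklore] -/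
theorem wcZ_code {G : SimpleGraph (Site 2)} {u v : Site 2} (m k : ℤ) (w : G.Walk u v) :
    wcZ m k (w.support.map toZ2) = wcross m k w := by
  rw [← SimpleGraph.Walk.cons_tail_support w, List.map_cons, wcZ, pcZ_map]
  rfl

/-- Membership in `faces`. [folklore] -/
theorem mem_faces {X0 X1 Y0 Y1 m k : ℤ} (h : (X0 ≤ m ∧ m < X1) ∧ (Y0 ≤ k ∧ k < Y1)) :
    (m, k) ∈ faces X0 X1 Y0 Y1 := by
  rw [faces, List.mem_product]
  simp only [List.mem_map, List.mem_range]
  exact ⟨⟨(m - X0).toNat, by omega, by omega⟩, ⟨(k - Y0).toNat, by omega, by omega⟩⟩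

variable {inV : ℤ × ℤ → Bool}
  (hB : ∀ x y : Site 2, (discreteDomainGraph Ω 1).Adj x y ↔
    (zdGraph 2).Adj x y ∧ inV (toZ2 x) = true ∧ inV (toZ2 y) = true)
include hB

/-- Every vertex of a walk of the discrete domain starting inside `inV` is inside `inV`. [folklore] -/
theorem inV_of_mem_support {u v : Site 2} (w : (discreteDomainGraph Ω 1).Walk u v) (hu : inV (toZ2 u) = true) :
    ∀ x ∈ w.support, inV (toZ2 x) = true := by
  induction w with
  | nil => intro x hx; rw [SimpleGraph.Walk.support_nil, List.mem_singleton] at hx; subst hx; exact hu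
  | cons h p ih =>
    intro x hx
    rw [SimpleGraph.Walk.support_cons, List.mem_cons] at hx
    rcases hx with rfl | hx
    · exact hu
    · exact ih ((hB _ _).1 h).2.2 x hx

/-- **Soundness of the left–right test**: `lrCode (code γ₁) (code γ₂) ⟹ γ₁ ≼ γ₂` (`wind_nonneg_iff_wcross`).
[folklore] -/
theorem lr_of_lrCode {X0 X1 Y0 Y1 : ℤ}
    (hbox : ∀ p, inV p = true → (X0 ≤ p.1 ∧ p.1 ≤ X1) ∧ (Y0 ≤ p.2 ∧ p.2 ≤ Y1)) (ha : inV (toZ2 a) = true)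
    (γ₁ γ₂ : SAW.DomainSAW Ω 1 a b)
    (h : lrCode X0 X1 Y0 Y1 (γ₁.walk.support.map toZ2) (γ₂.walk.support.map toZ2) = true) : CornerLoc.lr γ₁ γ₂ := by
  have hG : ∀ x y, (discreteDomainGraph Ω 1).Adj x y → (zdGraph 2).Adj x y := fun x y hxy => ((hB x y).1 hxy).1
  have hb : ∀ γ : SAW.DomainSAW Ω 1 a b, ∀ x ∈ γ.walk.support, (X0 ≤ x 0 ∧ x 0 ≤ X1) ∧ (Y0 ≤ x 1 ∧ x 1 ≤ Y1) :=
    fun γ x hx => hbox _ (inV_of_mem_support hB γ.walk ha x hx)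
  refine (wind_nonneg_iff_wcross hG γ₁.walk γ₂.walk (hb γ₁) (hb γ₂)).2 fun m k h1 h2 h3 h4 => ?_
  have := (List.all_eq_true.1 h) _ (mem_faces ⟨⟨h1, h2⟩, h3, h4⟩)
  rw [decide_eq_true_eq, wcZ_code, wcZ_code] at this
  exact this

/-- **Finite sums over chords as list sums over codes**: for an event `P` read on codes by `p`,
`Σ_{γ : P γ} g |γ| = Σ_{c ∈ L.filter p} g (|c| − 1)`. [folklore] -/
theorem sum_filter_eq_listSum {N : ℕ} (hN : ∀ γ : SAW.DomainSAW Ω 1 a b, γ.length ≤ N)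
    (hnodup : ((pathsFrom eqZ2 (nbV inV) N (toZ2 a) []).filter (endsAt eqZ2 (toZ2 b))).Nodup)
    [Fintype (SAW.DomainSAW Ω 1 a b)] (P : SAW.DomainSAW Ω 1 a b → Prop) [DecidablePred P] (p : Code → Bool)
    (hP : ∀ γ, P γ ↔ p (γ.walk.support.map toZ2) = true) (g : ℕ → ℝ) :
    ∑ γ ∈ Finset.univ.filter P, g γ.length =
      ((((pathsFrom eqZ2 (nbV inV) N (toZ2 a) []).filter (endsAt eqZ2 (toZ2 b))).filter p).map
        fun c => g (c.length - 1)).sum := by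
  classical
  set L := (pathsFrom eqZ2 (nbV inV) N (toZ2 a) []).filter (endsAt eqZ2 (toZ2 b)) with hL
  set code : SAW.DomainSAW Ω 1 a b → Code := fun γ => γ.walk.support.map toZ2 with hcode
  have hinj : Function.Injective code := Census.code_injective
  have hterm : ∀ γ : SAW.DomainSAW Ω 1 a b, g γ.length = g ((code γ).length - 1) := fun γ => by
    simp only [hcode, List.length_map, SimpleGraph.Walk.length_support, Nat.add_sub_cancel]
    rfl
  rw [← List.sum_toFinset _ (hnodup.filter p)]
  have hset : (L.filter p).toFinset = (Finset.univ.filter P).image code := by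
    ext c
    simp only [List.mem_toFinset, List.mem_filter, Finset.mem_image, Finset.mem_filter, Finset.mem_univ, true_and]
    constructor
    · rintro ⟨hc, hpc⟩
      obtain ⟨γ, hγ⟩ := Census.exists_chord_of_mem_enum hB hc
      exact ⟨γ, (hP γ).2 (hγ ▸ hpc), hγ⟩
    · rintro ⟨γ, hγ, rfl⟩
      exact ⟨Census.code_mem_enum hB hN γ, (hP γ).1 hγ⟩
  rw [hset, Finset.sum_image fun γ _ γ' _ h => hinj h]
  exact Finset.sum_congr rfl fun γ _ => hterm γ

end Dictionary

/-! ## §7b The certified enumeration is duplicate-free (no per-instance `decide`) -/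

section Nodup

open Summit.CriticalPhenomena.SAWScalingLimit.Theorems.BoundaryTP2.Negative (pathsFrom endsAt)
open Census (eqZ2 nbV)

/-- Every list of `pathsFrom eqb nb n w vis` starts with `w`. [folklore] -/
theorem exists_eq_cons_of_mem_pathsFrom {V : Type*} (eqb : V → V → Bool) (nb : V → List V) :
    ∀ (n : ℕ) (w : V) (vis : List V) (l : List V), l ∈ pathsFrom eqb nb n w vis → ∃ t, l = w :: t
  | 0, w, vis, l, h => by
    simp only [pathsFrom, List.mem_singleton] at h
    exact ⟨[], h⟩
  | n + 1, w, vis, l, h => by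
    simp only [pathsFrom, List.mem_cons, List.mem_flatMap, List.mem_map] at h
    rcases h with rfl | ⟨_, -, t, -, rfl⟩
    exacts [⟨[], rfl⟩, ⟨t, rfl⟩]

/-- **`pathsFrom` enumerates without repetition** when the neighbour lists are duplicate-free. [folklore] -/
theorem pathsFrom_nodup {V : Type*} (eqb : V → V → Bool) {nb : V → List V} (hnb : ∀ u, (nb u).Nodup) :
    ∀ (n : ℕ) (u : V) (vis : List V), (pathsFrom eqb nb n u vis).Nodup
  | 0, u, vis => by simp [pathsFrom]
  | n + 1, u, vis => by
    rw [pathsFrom, List.nodup_cons]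
    constructor
    · simp only [List.mem_flatMap, List.mem_map, not_exists, not_and]
      intro w _ t ht heq
      obtain ⟨t', rfl⟩ := exists_eq_cons_of_mem_pathsFrom eqb nb n w _ t ht
      simp at heq
    · rw [List.nodup_flatMap]
      refine ⟨fun w _ => (pathsFrom_nodup eqb hnb n w _).map (List.cons_injective), ?_⟩
      refine ((hnb u).filter _).pairwise_of_forall_ne fun w _ w' _ hne l hl hl' => hne ?_
      simp only [List.mem_map] at hl hl'
      obtain ⟨t, ht, rfl⟩ := hl
      obtain ⟨t', ht', heq⟩ := hl'
      obtain ⟨s, rfl⟩ := exists_eq_cons_of_mem_pathsFrom eqb nb n w _ t ht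
      obtain ⟨s', rfl⟩ := exists_eq_cons_of_mem_pathsFrom eqb nb n w' _ t' ht'
      simp only [List.cons.injEq] at heq
      exact heq.2.1.symm

/-- The box neighbour lists are duplicate-free. [folklore] -/
theorem nbV_nodup (inV : ℤ × ℤ → Bool) (p : ℤ × ℤ) : (nbV inV p).Nodup := by
  unfold nbV
  split_ifs
  · apply List.Nodup.filter
    obtain ⟨x, y⟩ := p
    simp only [List.nodup_cons, List.mem_cons, List.not_mem_nil, Prod.mk.injEq, or_false,
      not_or, List.nodup_nil, and_true, true_and, not_false_eq_true]
    refine ⟨⟨?_, ?_, ?_⟩, ⟨?_, ?_⟩, ?_⟩ <;> omega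
  · exact List.nodup_nil

/-- **The certified enumeration `codes` is duplicate-free**, for every box indicator, bound and endpoints. [folklore] -/
theorem codes_nodup (inV : ℤ × ℤ → Bool) (N : ℕ) (az bz : ℤ × ℤ) : (codes inV N az bz).Nodup :=
  (pathsFrom_nodup eqZ2 (nbV_nodup inV) N az []).filter _

end Nodup

end Summit.CriticalPhenomena.SAWScalingLimit.Theorems.LeftRightFKG.Negative.PAKit
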